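import Literature.Computability.Complexity.PlumbingBricks
import Literature.Computability.Complexity.FPStringBricks
import Literature.Computability.Complexity.PRelHierarchy
import Literature.Computability.Complexity.StackUnaryBits
import Literature.Computability.Complexity.CoinCounting
import Literature.Computability.Complexity.ProbabilisticClasses
import HarnessLib

/-!
# The majority-vote enumeration loop of `PP ⊆ PSPACE` (Gill 1977, Prop. 5.2(i)) as an `FP` step function

Trunk toolkit towards the named fact `Literature.Computability.QuantumComplexity.PP_subset_PSPACE`
(`QuantumComplexity/ClassicalClasses.lean`; Gill 1977, Prop. 5.2(i): "`ZPP ⊆ BPP ⊆ PP ⊆ PSPACE`",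
proof: "every polynomial bounded Turing machine can be simulated in polynomial space, and so
`PP ⊆ PSPACE`"; Arora–Barak 2009, Ex. 7.7). For the tree's `PP = pMajority P` — `x ∈ L` iff
strictly more than half of the coin strings `y ∈ {0,1}^{p(|x|)}` have `⟨x, y⟩ ∈ L'`, `L' ∈ P` —
the polynomial-space algorithm is the loop "for every `y ∈ {0,1}^m` in turn, run the decider of
`L'` on `⟨x, y⟩` and count; accept iff the count exceeds `2^{m-1}`", which reuses the space of
one run of the decider. This file provides the loop BODY as a string function in the tree's
`FP` algebra (no Turing machine is written) together with its complete orbit analysis; the space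
machine that iterates an `FP` function on a polynomially bounded orbit (the generic
"space-bounded iteration" device) is a separate file, and the assembly of `PP ⊆ PSPACE` from the
two is a one-screen corollary of the lemmas below.

* Over the tree's fixed-width numerals `natBits m i` (`StackUnaryBits.lean`) and carry pass
  `TokConv.ib` / `TokConv.co` (`TokenStreams.lean`): `CoinEnum.bitsToNat_natBits_mod`,
  `natBits_bitsToNat` (a bijection `{0, …, 2^m - 1} → {0,1}^m`), the successor on numerals
  (`ib_natBits_of_lt`, `co_natBits_of_lt`, `ib_natBits_last`, `co_natBits_last`), realised by the
  finite-state transducers `incT` / `carryT` (`incFn`, `carryFn ∈ FP`); `sum_range_ite_natBits`: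
  summing an indicator along the enumeration gives `cnt m E` (`CoinCounting.lean`);
  `encodeNat_two_pow_sub_one` (`bin (2^j - 1) = 1^j`).
* States `PPEnum.mkState f a y x c = f a ⟨y, ⟨x, c⟩⟩`: the done flag `f` and the answer bit `a`
  as the first two SYMBOLS of the word, then the pairing of the current coins `y`, the input `x`
  and the binary counter `c`; `stepFn L' p`:
  `f a ⟨y, ⟨x, c⟩⟩ ↦ (carry y) [p(|x|) < |c'|] ⟨succ y, ⟨x, c'⟩⟩`, `c' = c + [⟨x, y⟩ ∈ L']`
  (`stepFn_mkState`); `roundFn L' p = iteFn flagW id (stepFn L' p)` fixes flagged states;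
  `initFn p x = 0 0 ⟨0^m, ⟨x, 1^{m-1}⟩⟩` (the counter starts at `2^{m-1} - 1`, the padding trick
  of the proof of `PP ⊆ P^{#P}`, Arora–Barak Lemma 17.7, so that "majority" becomes "counter
  `≥ 2^m`", the length test `|bin c| > m` of `LengthCompare.lean`); `ansFn`: the second symbol.
  All are in `FP` for `L' ∈ P` (`roundFn_mem_FP`, `initFn_mem_FP`, `ansFn_mem_FP`; bricks
  `fanoutFn`, `iteFn`, `append_mem_FP`, `Brick.addFn`, `lenLeFn`, `indicatorFn_mem_FP`,
  `Plumb.polyFn`, `Kannan.zerosFn`, `take1Fn`, `PRelSigma.tail_mem_FP`).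
* **Orbit** (`iterate_roundFn_initFn`): after `k ≤ 2^m` rounds the state is
  `[k = 2^m] (ansBit k) ⟨natBits m (k mod 2^m), ⟨x, counter k⟩⟩` with
  `counter k = bin (2^{m-1} - 1 + acc k)`, `acc k = #{i < k | ⟨x, natBits m i⟩ ∈ L'}`, and it is
  fixed afterwards (`iterate_roundFn_initFn_of_le`); the flag is `[2^m ≤ n]` after `n` rounds
  (`flagW_iterate_roundFn_initFn`); every state of the orbit has length `≤ 2|x| + 3 p(|x|) + 7`
  (`length_iterate_roundFn_initFn_le`); `acc (2^m) = cnt m {y | ⟨x, y⟩ ∈ L'}` (`acc_two_pow`), so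
  from round `2^m` on the state is `1 [2^m < 2 · cnt] ⟨0^m, ⟨x, counter (2^m)⟩⟩`
  (`iterate_roundFn_initFn_eq_of_le`, `ansBit_two_pow`), whose answer bit is `[x ∈ L]` for a
  `pMajority` witness `(L', p)` of `L` (`ansFn_iterate_eq_encodeBool`,
  `iterate_roundFn_initFn_eq_cons`, via `half_lt_uniformProb_iff`).

## References

* J. Gill, *Computational complexity of probabilistic Turing machines*, SIAM J. Comput. 6 (1977)
  675–695 [Gill1977] (held: `paper:doi-10-1137-0206049`): Def. 5.1 (`PP`), Prop. 5.2(i) and its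
  proof, p. 685 (`PP ⊆ PSPACE` by the space-bounded simulation in the proof of Prop. 3.5, p. 680).
* S. Arora, B. Barak, *Computational Complexity: A Modern Approach*, CUP 2009 [AroraBarak2009]:
  Ex. 7.7 (`BPP ⊆ PP ⊆ PSPACE`), §17.2.1 and Lemma 17.7 (the padding by `2^{m-1} - 1`), §1.3 and
  Thm. 2.8 (closure of polynomial time under composition), Thm. 4.2 (time-`T` machines use space
  `O(T)`).

## Design notes

* Everything is over `List Bool`; the flag and the answer are the first two symbols of the state
  word (a space machine iterating the round function can test the flag and read the answer by
  popping two symbols), the rest is the pairing `boolPair`.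
* The round function is made idempotent on flagged states (`iteFn flagW id`) so that the orbit is
  bounded for ALL iteration counts, whatever halting convention the iterating machine uses.
* The counter is kept canonical (`Brick.addFn` outputs `encodeNat`), so that the majority test is
  the length comparison `|bin c| > m` (`lenLeFn`).
-/

noncomputable section

namespace Literature.Computability.Complexity

open _root_.Computability Polynomial Brick

namespace CoinEnum

/-! ### Fixed-width little-endian numerals (`natBits`, `StackUnaryBits.lean`) -/

/-- Value of `natBits m i` for every `i`: `i mod 2^m` (the tree's `bitsToNat_natBits` is the case
`i < 2^m`). [folklore] -/
theorem bitsToNat_natBits_mod : ∀ m i, bitsToNat (natBits m i) = i % 2 ^ m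
  | 0, i => by simp [natBits, Nat.mod_one]
  | m + 1, i => by
    rw [natBits, bitsToNat_cons, bitsToNat_natBits_mod m, pow_succ', Nat.mod_mul]
    rcases Nat.mod_two_eq_zero_or_one i with h | h <;> simp [h]

/-- `natBits` inverts `bitsToNat` on strings of the given length. [folklore] -/
theorem natBits_bitsToNat : ∀ l : List Bool, natBits l.length (bitsToNat l) = l
  | [] => rfl
  | b :: l => by
    rw [List.length_cons, natBits, bitsToNat_cons]
    have h2 : (b.toNat + 2 * bitsToNat l) / 2 = bitsToNat l := by
      cases b
      · simp
      · simp only [Bool.toNat_true]; omega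
    have h1 : decide ((b.toNat + 2 * bitsToNat l) % 2 = 1) = b := by
      cases b
      · simp
      · simp only [Bool.toNat_true, decide_eq_true_eq]; omega
    rw [h1, h2, natBits_bitsToNat l]

/-- A string of length `m` is `natBits m` of its value. [folklore] -/
theorem eq_natBits_of_length {m : ℕ} {l : List Bool} (h : l.length = m) : l = natBits m (bitsToNat l) := by
  subst h; exact (natBits_bitsToNat l).symm

/-- `natBits m 0 = 0^m`. [folklore] -/
theorem natBits_zero : ∀ m, natBits m 0 = List.replicate m false
  | 0 => rfl
  | m + 1 => by simp [natBits, natBits_zero m, List.replicate_succ]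

/-! ### The carry pass (`TokConv.ib` / `TokConv.co`, `TokenStreams.lean`) on fixed-width numerals -/

/-- The carry pass keeps the length. [folklore] -/
@[simp] theorem length_ib : ∀ (c : Bool) (l : List Bool), (TokConv.ib c l).length = l.length
  | c, [] => rfl
  | c, b :: l => by simp [TokConv.ib, length_ib]

/-- The arithmetic of the carry pass at fixed width: written bits plus `2^{|l|}` times the
carry-out is value plus carry-in (`TokConv.bitsToNat_incRes` split at the final carry). [folklore] -/
theorem bitsToNat_ib_add (c : Bool) (l : List Bool) :
    bitsToNat (TokConv.ib c l) + 2 ^ l.length * (TokConv.co c l).toNat = bitsToNat l + c.toNat := by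
  rw [← TokConv.bitsToNat_incRes, TokConv.incRes, bitsToNat_append, length_ib, TokConv.bitsToNat_flag]

/-- Successor below the wrap-around: no carry out. [folklore] -/
theorem co_natBits_of_lt {m i : ℕ} (hi : i + 1 < 2 ^ m) : TokConv.co true (natBits m i) = false := by
  have hv := bitsToNat_ib_add true (natBits m i)
  rw [bitsToNat_natBits (by omega), length_natBits] at hv
  have hlt := bitsToNat_lt (TokConv.ib true (natBits m i))
  rw [length_ib, length_natBits] at hlt
  cases h : TokConv.co true (natBits m i)
  · rfl
  · rw [h] at hv; simp at hv; omega

/-- Successor below the wrap-around: the written bits are the next numeral. [folklore] -/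
theorem ib_natBits_of_lt {m i : ℕ} (hi : i + 1 < 2 ^ m) : TokConv.ib true (natBits m i) = natBits m (i + 1) := by
  have hv := bitsToNat_ib_add true (natBits m i)
  rw [bitsToNat_natBits (by omega), length_natBits, co_natBits_of_lt hi] at hv
  simp only [Bool.toNat_false, mul_zero, add_zero, Bool.toNat_true] at hv
  rw [eq_natBits_of_length (length_ib true (natBits m i)), length_natBits, hv]

/-- Successor of the last string `1^m = natBits m (2^m - 1)`: carry out. [folklore] -/
theorem co_natBits_last (m : ℕ) : TokConv.co true (natBits m (2 ^ m - 1)) = true := by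
  have hpos : 0 < 2 ^ m := Nat.two_pow_pos m
  have hv := bitsToNat_ib_add true (natBits m (2 ^ m - 1))
  rw [bitsToNat_natBits (by omega), length_natBits] at hv
  have hlt := bitsToNat_lt (TokConv.ib true (natBits m (2 ^ m - 1)))
  rw [length_ib, length_natBits] at hlt
  cases h : TokConv.co true (natBits m (2 ^ m - 1))
  · rw [h] at hv; simp at hv; omega
  · rfl

/-- Successor of the last string: the written bits wrap around to `0^m`. [folklore] -/
theorem ib_natBits_last (m : ℕ) : TokConv.ib true (natBits m (2 ^ m - 1)) = natBits m 0 := by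
  have hpos : 0 < 2 ^ m := Nat.two_pow_pos m
  have hv := bitsToNat_ib_add true (natBits m (2 ^ m - 1))
  rw [bitsToNat_natBits (by omega), length_natBits, co_natBits_last] at hv
  simp only [Bool.toNat_true, mul_one] at hv
  rw [eq_natBits_of_length (length_ib true (natBits m _)), length_natBits]
  congr 1
  omega

/-! ### Numerals `2^j - 1` -/

/-- The canonical numeral of `2^j - 1` is `1^j`: both are canonical numerals
(`encodeNat_canonical`) of the same value (`TM2Pass.bitsToNat_ones_append_succ`; the named form
`bitsToNat (ones j) = 2^j - 1` is `Brick.bitsToNat_ones` of `FoldBricks.lean`), hence equal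
(`eq_of_bitsToNat_eq_of_canonical`). [folklore] -/
theorem encodeNat_two_pow_sub_one (j : ℕ) : encodeNat (2 ^ j - 1) = ones j := by
  have hv : bitsToNat (ones j) = 2 ^ j - 1 := by
    have h := TM2Pass.bitsToNat_ones_append_succ j []
    simp only [List.append_nil, bitsToNat_nil, Nat.zero_add, Nat.mul_one] at h
    have : 0 < 2 ^ j := Nat.two_pow_pos j
    change bitsToNat (List.replicate j true) = _
    omega
  refine eq_of_bitsToNat_eq_of_canonical _ _ (encodeNat_canonical _) ?_ (by rw [bitsToNat_encodeNat, hv])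
  cases j with
  | zero => exact Or.inl rfl
  | succ j => exact Or.inr ⟨ones j, List.replicate_succ' ..⟩

/-! ### Counting over the enumeration -/

/-- Summing an indicator over `natBits m 0, …, natBits m (2^m - 1)` counts the strings of length `m`
in the event (`cnt`, `CoinCounting.lean`): `natBits m` is a bijection from `{0, …, 2^m - 1}` onto
`{0,1}^m`. [folklore] -/
theorem sum_range_ite_natBits (m : ℕ) (E : Set (List Bool)) [DecidablePred (· ∈ E)] :
    (∑ i ∈ Finset.range (2 ^ m), if natBits m i ∈ E then 1 else 0) = cnt m E := by
  classical
  unfold cnt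
  rw [Finset.card_filter]
  refine Finset.sum_nbij' (fun i => ⟨natBits m i, length_natBits m i⟩) (fun v => bitsToNat v.toList)
    (fun _ _ => Finset.mem_univ _) (fun v _ => ?_) (fun i hi => ?_) (fun v _ => ?_) (fun i _ => ?_)
  · exact Finset.mem_range.2 (by simpa using bitsToNat_lt v.toList)
  · simp only [List.Vector.toList_mk]
    exact bitsToNat_natBits (Finset.mem_range.1 hi)
  · apply List.Vector.toList_injective
    simp only [List.Vector.toList_mk]
    exact (eq_natBits_of_length (List.Vector.toList_length v)).symm
  · simp

/-! ### The successor as a finite-state transduction -/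

/-- The ripple-carry transducer (state = carry, initially `1`): on input `y` it emits the carry
pass `TokConv.ib true y`, the successor of `y` modulo `2^{|y|}`. [folklore] -/
def incT : FST Bool Bool Bool where
  init := true
  step c b := (b && c, [b ^^ c])
  front _ := []
  keep _ := true

/-- The carry-out transducer: same transitions as `incT`, but it only reports the final carry
`[TokConv.co true y]` (the emitted body is discarded). [folklore] -/
def carryT : FST Bool Bool Bool where
  init := true
  step c b := (b && c, [b ^^ c])
  front c := [c]
  keep _ := false

/-- Transitions of `incT`. [folklore] -/
@[simp] theorem incT_step (c b : Bool) : incT.step c b = (b && c, [b ^^ c]) := rfl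

/-- Transitions of `carryT`. [folklore] -/
@[simp] theorem carryT_step (c b : Bool) : carryT.step c b = (b && c, [b ^^ c]) := rfl

/-- The run of `incT` is the carry pass. [folklore] -/
theorem incT_run (c : Bool) (l : List Bool) : incT.run c l = (TokConv.co c l, TokConv.ib c l) := by
  induction l generalizing c with
  | nil => rfl
  | cons b l ih => rw [FST.run_cons, incT_step, ih]; rfl

/-- The run of `carryT` is the carry pass. [folklore] -/
theorem carryT_run (c : Bool) (l : List Bool) : carryT.run c l = (TokConv.co c l, TokConv.ib c l) := by
  induction l generalizing c with
  | nil => rfl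
  | cons b l ih => rw [FST.run_cons, carryT_step, ih]; rfl

/-- `incFn y = TokConv.ib true y`: the successor of `y` as a `|y|`-bit little-endian numeral,
wrapping around to `0^{|y|}`. [folklore] -/
def incFn : List Bool → List Bool := incT.eval

/-- `carryFn y = [TokConv.co true y]`: the carry out of the successor (`[1]` iff `y = 1^{|y|}`).
[folklore] -/
def carryFn : List Bool → List Bool := carryT.eval

/-- Value of `incFn`. [folklore] -/
@[simp] theorem incFn_apply (y : List Bool) : incFn y = TokConv.ib true y := by
  change incT.front (incT.run incT.init y).1 ++
    (if incT.keep (incT.run incT.init y).1 then (incT.run incT.init y).2 else []) = _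
  rw [show incT.init = true from rfl, incT_run]
  rfl

/-- Value of `carryFn`. [folklore] -/
@[simp] theorem carryFn_apply (y : List Bool) : carryFn y = [TokConv.co true y] := by
  change carryT.front (carryT.run carryT.init y).1 ++
    (if carryT.keep (carryT.run carryT.init y).1 then (carryT.run carryT.init y).2 else []) = _
  rw [show carryT.init = true from rfl, carryT_run]
  rfl

/-- `incFn ∈ FP` (a finite-state transduction). [folklore] -/
theorem incFn_mem_FP : incFn ∈ FP := incT.polyTimeComputable_eval

/-- `carryFn ∈ FP` (a finite-state transduction). [folklore] -/
theorem carryFn_mem_FP : carryFn ∈ FP := carryT.polyTimeComputable_eval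

end CoinEnum

open CoinEnum

namespace PPEnum

/-! ### The state of the enumeration and the round function -/

section Loop

variable (L' : Language Bool) (p : Polynomial ℕ)

/-- The state `f a ⟨y, ⟨x, c⟩⟩` of the enumeration: the done flag `f` and the answer bit `a` as
the first two SYMBOLS of the word, then the pairing of the current coin string `y ∈ {0,1}^m`,
the input `x` and the binary counter `c` (little-endian numeral). [cite: Gill1977, Prop. 5.2(i) (proof: PP ⊆ PSPACE by enumerating the coin sequences in polynomial space)] -/
def mkState (f a : Bool) (y x c : List Bool) : List Bool :=
  f :: a :: boolPair y (boolPair x c)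

/-- Length of a state. [folklore] -/
theorem length_mkState (f a : Bool) (y x c : List Bool) :
    (mkState f a y x c).length = 2 * x.length + 2 * y.length + c.length + 6 := by
  simp only [mkState, length_boolPair, List.length_cons]
  ring

/-- The first symbol of a state is its flag. [folklore] -/
theorem mkState_eq_cons (f a : Bool) (y x c : List Bool) :
    mkState f a y x c = f :: a :: boolPair y (boolPair x c) := rfl

/-- Accessor: the flag, as the one-bit string `[f]`. [folklore] -/
def flagW : List Bool → List Bool := take1Fn
/-- Accessor: the body `⟨y, ⟨x, c⟩⟩` (drop the two leading symbols). [folklore] -/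
def bodyW : List Bool → List Bool := List.tail ∘ List.tail
/-- Accessor: the coin string `y`. [folklore] -/
def coinsW : List Bool → List Bool := fstF ∘ bodyW
/-- Accessor: the input `x`. [folklore] -/
def inputW : List Bool → List Bool := fstF ∘ sndF ∘ bodyW
/-- Accessor: the counter `c`. [folklore] -/
def countW : List Bool → List Bool := sndF ∘ sndF ∘ bodyW

/-- `flagW` on a state. [folklore] -/
@[simp] theorem flagW_mkState (f a : Bool) (y x c : List Bool) : flagW (mkState f a y x c) = [f] := rfl
/-- `bodyW` on a state. [folklore] -/
@[simp] theorem bodyW_mkState (f a : Bool) (y x c : List Bool) :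
    bodyW (mkState f a y x c) = boolPair y (boolPair x c) := rfl
/-- `coinsW` on a state. [folklore] -/
@[simp] theorem coinsW_mkState (f a : Bool) (y x c : List Bool) : coinsW (mkState f a y x c) = y := by
  simp [coinsW]
/-- `inputW` on a state. [folklore] -/
@[simp] theorem inputW_mkState (f a : Bool) (y x c : List Bool) : inputW (mkState f a y x c) = x := by
  simp [inputW]
/-- `countW` on a state. [folklore] -/
@[simp] theorem countW_mkState (f a : Bool) (y x c : List Bool) : countW (mkState f a y x c) = c := by
  simp [countW]

/-- The accessors are in `FP`. [folklore] -/
theorem flagW_mem_FP : flagW ∈ FP := take1Fn_mem_FP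
/-- The accessors are in `FP`. [folklore] -/
theorem bodyW_mem_FP : bodyW ∈ FP := comp_mem_FP PRelSigma.tail_mem_FP PRelSigma.tail_mem_FP
/-- The accessors are in `FP`. [folklore] -/
theorem coinsW_mem_FP : coinsW ∈ FP := comp_mem_FP fstF_mem_FP bodyW_mem_FP
/-- The accessors are in `FP`. [folklore] -/
theorem inputW_mem_FP : inputW ∈ FP := comp_mem_FP fstF_mem_FP (comp_mem_FP sndF_mem_FP bodyW_mem_FP)
/-- The accessors are in `FP`. [folklore] -/
theorem countW_mem_FP : countW ∈ FP := comp_mem_FP sndF_mem_FP (comp_mem_FP sndF_mem_FP bodyW_mem_FP)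

/-- The vote of the current coin string: `[⟨x, y⟩ ∈ L']` (one run of the decider of the witness
language `L' ∈ P`). [cite: Gill1977, Prop. 5.2(i) (proof)] -/
def voteFn : List Bool → List Bool :=
  (fun w => encodeBool (L'.boolIndicator w)) ∘ fanoutFn inputW coinsW

/-- The vote on a state. [folklore] -/
@[simp] theorem voteFn_mkState (f a : Bool) (y x c : List Bool) :
    voteFn L' (mkState f a y x c) = [L'.boolIndicator (boolPair x y)] := by
  simp [voteFn, encodeBool]

/-- The new counter `c + [⟨x, y⟩ ∈ L']`, in canonical binary (`Brick.addFn`). [folklore] -/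
def cNewFn : List Bool → List Bool := addFn ∘ fanoutFn countW (voteFn L')

/-- The new counter on a state. [folklore] -/
@[simp] theorem cNewFn_mkState (f a : Bool) (y x c : List Bool) :
    cNewFn L' (mkState f a y x c) = encodeNat (bitsToNat c + (L'.boolIndicator (boolPair x y)).toNat) := by
  simp [cNewFn]

/-- The new answer bit `[p(|x|) < |c'|]` for the new counter `c'` (negation of the length test
`lenLeFn p ⟨x, c'⟩ = [|c'| ≤ p(|x|)]` of `LengthCompare.lean`): for the canonical counters of the
orbit this is `[c' ≥ 2^{p(|x|)}]`. [folklore] -/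
def aNewFn : List Bool → List Bool :=
  iteFn (lenLeFn p ∘ fanoutFn inputW (cNewFn L')) (fun _ => [false]) (fun _ => [true])

/-- The new answer bit on a state. [folklore] -/
theorem aNewFn_mkState (f a : Bool) (y x c : List Bool) :
    aNewFn L' p (mkState f a y x c) =
      [decide (p.eval x.length <
        (encodeNat (bitsToNat c + (L'.boolIndicator (boolPair x y)).toNat)).length)] := by
  set c' := encodeNat (bitsToNat c + (L'.boolIndicator (boolPair x y)).toNat) with hc'
  have hc : (lenLeFn p ∘ fanoutFn inputW (cNewFn L')) (mkState f a y x c) =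
      [decide (c'.length ≤ p.eval x.length)] := by
    simp only [Function.comp_apply, fanoutFn_apply, inputW_mkState, cNewFn_mkState, lenLeFn_boolPair, ← hc']
  by_cases h : c'.length ≤ p.eval x.length
  · rw [aNewFn, iteFn_apply_true (by rw [hc, decide_eq_true h]), decide_eq_false (Nat.not_lt.2 h)]
  · rw [aNewFn, iteFn_apply_false (by rw [hc, decide_eq_false h]), decide_eq_true (Nat.lt_of_not_le h)]

/-- The new body `⟨succ y, ⟨x, c'⟩⟩`. [folklore] -/
def bodyNewFn : List Bool → List Bool := fanoutFn (incFn ∘ coinsW) (fanoutFn inputW (cNewFn L'))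

/-- The new answer bit followed by the new body. [folklore] -/
def midFn : List Bool → List Bool := fun w => aNewFn L' p w ++ bodyNewFn L' w

/-- **One step of the enumeration**:
`f a ⟨y, ⟨x, c⟩⟩ ↦ (carry y) [p(|x|) < |c'|] ⟨succ y, ⟨x, c'⟩⟩`, `c' = c + [⟨x, y⟩ ∈ L']`.
[cite: Gill1977, Prop. 5.2(i) (proof)] -/
def stepFn : List Bool → List Bool := fun w => (carryFn ∘ coinsW) w ++ midFn L' p w

/-- The step on a state. [folklore] -/
theorem stepFn_mkState (f a : Bool) (y x c : List Bool) :
    stepFn L' p (mkState f a y x c) =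
      mkState (TokConv.co true y)
        (decide (p.eval x.length < (encodeNat (bitsToNat c + (L'.boolIndicator (boolPair x y)).toNat)).length))
        (TokConv.ib true y) x (encodeNat (bitsToNat c + (L'.boolIndicator (boolPair x y)).toNat)) := by
  rw [stepFn, midFn, aNewFn_mkState]
  simp only [bodyNewFn, Function.comp_apply, fanoutFn_apply, coinsW_mkState, inputW_mkState, cNewFn_mkState,
    carryFn_apply, incFn_apply]
  rfl

/-- **The round function**: the identity on flagged states, `stepFn` otherwise (so that the orbit
is eventually constant and globally bounded in length). [cite: Gill1977, Prop. 5.2(i) (proof)] -/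
def roundFn : List Bool → List Bool := iteFn flagW id (stepFn L' p)

/-- A flagged state is fixed. [folklore] -/
theorem roundFn_mkState_true (a : Bool) (y x c : List Bool) :
    roundFn L' p (mkState true a y x c) = mkState true a y x c := by
  rw [roundFn, iteFn_apply_true (flagW_mkState true a y x c)]; rfl

/-- An unflagged state is stepped. [folklore] -/
theorem roundFn_mkState_false (a : Bool) (y x c : List Bool) :
    roundFn L' p (mkState false a y x c) = stepFn L' p (mkState false a y x c) := by
  rw [roundFn, iteFn_apply_false (flagW_mkState false a y x c)]

/-- **The initial state** of input `x`: `0 0 ⟨0^m, ⟨x, 1^{m-1}⟩⟩` with `m = p(|x|)`; the counter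
starts at `2^{m-1} - 1` (numeral `1^{m-1}`) so that the final majority test `#acc > 2^{m-1}` becomes
the overflow test `counter ≥ 2^m` (cf. the proof of `PP ⊆ P^{#P}`, Arora–Barak 2009, Lemma 17.7).
[cite: Gill1977, Prop. 5.2(i) (proof)] -/
def initFn : List Bool → List Bool :=
  List.cons false ∘ List.cons false ∘
    fanoutFn (Kannan.zerosFn ∘ Plumb.polyFn p)
      (fanoutFn id (Plumb.dropFn ∘ fanoutFn (fun _ => [true]) (Plumb.polyFn p)))

/-- The initial state. [folklore] -/
theorem initFn_apply (x : List Bool) :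
    initFn p x = mkState false false (natBits (p.eval x.length) 0) x (ones (p.eval x.length - 1)) := by
  simp [initFn, mkState, natBits_zero, ones, List.drop_replicate]

/-- **The answer** read off a state: its second symbol, as a one-bit string. [folklore] -/
def ansFn : List Bool → List Bool := take1Fn ∘ List.tail

/-- The answer on a state. [folklore] -/
@[simp] theorem ansFn_mkState (f a : Bool) (y x c : List Bool) : ansFn (mkState f a y x c) = [a] := rfl

/-- The vote is in `FP` when `L' ∈ P`. [cite: AroraBarak2009, Def. 1.13] -/
theorem voteFn_mem_FP (hL' : L' ∈ Classes.P) : voteFn L' ∈ FP :=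
  comp_mem_FP (indicatorFn_mem_FP hL') (fanoutFn_mem_FP inputW_mem_FP coinsW_mem_FP)

/-- The new counter is in `FP` when `L' ∈ P`. [cite: AroraBarak2009, §1.3 (closure of polynomial time under composition)] -/
theorem cNewFn_mem_FP (hL' : L' ∈ Classes.P) : cNewFn L' ∈ FP :=
  comp_mem_FP addFn_mem_FP (fanoutFn_mem_FP countW_mem_FP (voteFn_mem_FP L' hL'))

/-- The new answer bit is in `FP` when `L' ∈ P`. [cite: AroraBarak2009, §1.3] -/
theorem aNewFn_mem_FP (hL' : L' ∈ Classes.P) : aNewFn L' p ∈ FP :=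
  iteFn_mem_FP (comp_mem_FP (lenLeFn_mem_FP p) (fanoutFn_mem_FP inputW_mem_FP (cNewFn_mem_FP L' hL')))
    (const_mem_FP _) (const_mem_FP _)

/-- The new body is in `FP` when `L' ∈ P`. [cite: AroraBarak2009, §1.3] -/
theorem bodyNewFn_mem_FP (hL' : L' ∈ Classes.P) : bodyNewFn L' ∈ FP :=
  fanoutFn_mem_FP (comp_mem_FP incFn_mem_FP coinsW_mem_FP) (fanoutFn_mem_FP inputW_mem_FP (cNewFn_mem_FP L' hL'))

/-- The step is in `FP` when `L' ∈ P`. [cite: AroraBarak2009, §1.3] -/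
theorem stepFn_mem_FP (hL' : L' ∈ Classes.P) : stepFn L' p ∈ FP :=
  append_mem_FP (comp_mem_FP carryFn_mem_FP coinsW_mem_FP)
    (append_mem_FP (aNewFn_mem_FP L' p hL') (bodyNewFn_mem_FP L' hL'))

/-- **The round function is in `FP`** when `L' ∈ P`. [cite: AroraBarak2009, §1.3] -/
theorem roundFn_mem_FP (hL' : L' ∈ Classes.P) : roundFn L' p ∈ FP :=
  iteFn_mem_FP flagW_mem_FP OracleCompose.id_mem_FP (stepFn_mem_FP L' p hL')

/-- The initial-state map is in `FP`. [cite: AroraBarak2009, §1.3] -/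
theorem initFn_mem_FP : initFn p ∈ FP :=
  comp_mem_FP (cons_mem_FP false) (comp_mem_FP (cons_mem_FP false)
    (fanoutFn_mem_FP (comp_mem_FP Kannan.zerosFn_mem_FP (Plumb.polyFn_mem_FP p))
      (fanoutFn_mem_FP OracleCompose.id_mem_FP
        (comp_mem_FP Plumb.dropFn_mem_FP (fanoutFn_mem_FP (const_mem_FP _) (Plumb.polyFn_mem_FP p))))))

/-- The answer map is in `FP`. [cite: AroraBarak2009, §1.3] -/
theorem ansFn_mem_FP : ansFn ∈ FP := comp_mem_FP take1Fn_mem_FP PRelSigma.tail_mem_FP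

/-! ### The orbit of the initial state -/

/-- The number of accepted coin strings among the first `k` enumerated ones,
`#{i < k | ⟨x, natBits m i⟩ ∈ L'}`. [cite: Gill1977, Prop. 5.2(i) (proof)] -/
def acc (x : List Bool) (m k : ℕ) : ℕ :=
  ∑ i ∈ Finset.range k, (L'.boolIndicator (boolPair x (natBits m i))).toNat

/-- `acc` at `k + 1`. [folklore] -/
theorem acc_succ (x : List Bool) (m k : ℕ) :
    acc L' x m (k + 1) = acc L' x m k + (L'.boolIndicator (boolPair x (natBits m k))).toNat :=
  Finset.sum_range_succ _ _

/-- `acc ≤ k`. [folklore] -/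
theorem acc_le (x : List Bool) (m k : ℕ) : acc L' x m k ≤ k := by
  induction k with
  | zero => simp [acc]
  | succ k ih => rw [acc_succ]; cases L'.boolIndicator (boolPair x (natBits m k)) <;> simp <;> omega

/-- **The full count**: after the `2^m` strings of length `m`, `acc` is the number
`cnt m {y | ⟨x, y⟩ ∈ L'}` of accepted coin strings (`CoinCounting.lean`). [cite: Gill1977, Prop. 5.2(i) (proof)] -/
theorem acc_two_pow (x : List Bool) (m : ℕ) :
    acc L' x m (2 ^ m) = cnt m {y | boolPair x y ∈ L'} := by
  classical
  rw [acc, ← sum_range_ite_natBits]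
  refine Finset.sum_congr rfl fun i _ => ?_
  by_cases h : boolPair x (natBits m i) ∈ L'
  · rw [(Set.mem_iff_boolIndicator _ _).1 h, if_pos (by exact h)]; rfl
  · rw [(Set.notMem_iff_boolIndicator _ _).1 h, if_neg (by exact h)]; rfl

/-- The counter of the orbit after `k` rounds: `bin (2^{m-1} - 1 + acc k)`. [folklore] -/
def counter (x : List Bool) (k : ℕ) : List Bool :=
  encodeNat (2 ^ (p.eval x.length - 1) - 1 + acc L' x (p.eval x.length) k)

/-- The answer bit of the orbit after `k` rounds: `[p(|x|) < |counter k|]`. [folklore] -/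
def ansBit (x : List Bool) (k : ℕ) : Bool :=
  decide (p.eval x.length < (counter L' p x k).length)

/-- **The orbit.** After `k ≤ 2^m` rounds (`m = p(|x|)`) the state is
`[k = 2^m] (ansBit k) ⟨natBits m (k mod 2^m), ⟨x, counter k⟩⟩`. [cite: Gill1977, Prop. 5.2(i) (proof)] -/
theorem iterate_roundFn_initFn (x : List Bool) (k : ℕ) (hk : k ≤ 2 ^ p.eval x.length) :
    (roundFn L' p)^[k] (initFn p x) =
      mkState (decide (k = 2 ^ p.eval x.length)) (ansBit L' p x k)
        (natBits (p.eval x.length) (k % 2 ^ p.eval x.length)) x (counter L' p x k) := by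
  set m := p.eval x.length with hm
  have hpos : 0 < 2 ^ m := Nat.two_pow_pos m
  induction k with
  | zero =>
    have hc : counter L' p x 0 = ones (m - 1) := by
      simp only [counter, acc, Finset.range_zero, Finset.sum_empty, add_zero, ← hm,
        encodeNat_two_pow_sub_one]
    rw [Function.iterate_zero, id, initFn_apply, ← hm, ansBit, hc, Nat.zero_mod, ← hm]
    congr 1
    · rw [decide_eq_false]; omega
    · rw [decide_eq_false]; simp only [ones, List.length_replicate]; omega
  | succ k ih =>
    have hk' : k < 2 ^ m := hk
    have hc : counter L' p x (k + 1) =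
        encodeNat (bitsToNat (counter L' p x k) + (L'.boolIndicator (boolPair x (natBits m k))).toNat) := by
      simp only [counter, bitsToNat_encodeNat, ← hm, acc_succ, add_assoc]
    rw [Function.iterate_succ_apply', ih hk'.le, decide_eq_false (Nat.ne_of_lt hk'),
      roundFn_mkState_false, stepFn_mkState, Nat.mod_eq_of_lt hk', ← hm, ansBit, hc]
    rcases Nat.lt_or_eq_of_le (Nat.succ_le_of_lt hk') with hlt | heq
    · rw [co_natBits_of_lt hlt, ib_natBits_of_lt hlt, Nat.mod_eq_of_lt hlt, decide_eq_false (Nat.ne_of_lt hlt)]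
    · have hk1 : k = 2 ^ m - 1 := by omega
      subst hk1
      rw [co_natBits_last, ib_natBits_last, Nat.sub_add_cancel hpos, Nat.mod_self, decide_eq_true rfl]

/-- The state after `2^m` rounds is flagged, hence fixed by all further rounds. [folklore] -/
theorem iterate_roundFn_initFn_of_le (x : List Bool) {n : ℕ} (hn : 2 ^ p.eval x.length ≤ n) :
    (roundFn L' p)^[n] (initFn p x) = (roundFn L' p)^[2 ^ p.eval x.length] (initFn p x) := by
  obtain ⟨d, rfl⟩ := Nat.exists_eq_add_of_le hn
  induction d with
  | zero => rfl
  | succ d ih =>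
    rw [← Nat.add_assoc, Function.iterate_succ_apply', ih (Nat.le_add_right _ _),
      iterate_roundFn_initFn L' p x _ le_rfl, decide_eq_true rfl, roundFn_mkState_true]

/-- **The flag** is raised exactly from round `2^m` on. [folklore] -/
theorem flagW_iterate_roundFn_initFn (x : List Bool) (n : ℕ) :
    flagW ((roundFn L' p)^[n] (initFn p x)) = [decide (2 ^ p.eval x.length ≤ n)] := by
  rcases le_or_gt (2 ^ p.eval x.length) n with h | h
  · rw [iterate_roundFn_initFn_of_le L' p x h, iterate_roundFn_initFn L' p x _ le_rfl, flagW_mkState,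
      decide_eq_true rfl, decide_eq_true h]
  · rw [iterate_roundFn_initFn L' p x n h.le, flagW_mkState, decide_eq_false (Nat.ne_of_lt h),
      decide_eq_false (Nat.not_le.2 h)]

/-- The counter stays below `2^{m+1}`: `|counter k| ≤ m + 1` for `k ≤ 2^m`. [folklore] -/
theorem length_counter_le (x : List Bool) {k : ℕ} (hk : k ≤ 2 ^ p.eval x.length) :
    (counter L' p x k).length ≤ p.eval x.length + 1 := by
  set m := p.eval x.length with hm
  rw [counter, ← hm, TM2Pass.length_encodeNat_eq_size, Nat.size_le, pow_succ]
  have hacc := acc_le L' x m k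
  have hpos : 0 < 2 ^ m := Nat.two_pow_pos m
  have h1 : 2 ^ (m - 1) ≤ 2 ^ m := Nat.pow_le_pow_right two_pos (Nat.sub_le m 1)
  omega

/-- **Space bound**: every state of the orbit has length `≤ 2|x| + 3 p(|x|) + 7`.
[cite: Gill1977, Prop. 5.2(i) (proof: polynomial space)] -/
theorem length_iterate_roundFn_initFn_le (x : List Bool) (n : ℕ) :
    ((roundFn L' p)^[n] (initFn p x)).length ≤ 2 * x.length + 3 * p.eval x.length + 7 := by
  set m := p.eval x.length with hm
  obtain ⟨k, hk, hkn⟩ : ∃ k ≤ 2 ^ m, (roundFn L' p)^[n] (initFn p x) = (roundFn L' p)^[k] (initFn p x) := by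
    rcases le_or_gt (2 ^ m) n with h | h
    · exact ⟨2 ^ m, le_rfl, iterate_roundFn_initFn_of_le L' p x h⟩
    · exact ⟨n, h.le, rfl⟩
  rw [hkn, iterate_roundFn_initFn L' p x k hk, length_mkState, length_natBits]
  have := length_counter_le L' p x hk
  simp only [← hm] at this ⊢
  omega

/-- **The final answer bit** is the majority verdict `[2^m < 2 · #{y ∈ {0,1}^m | ⟨x, y⟩ ∈ L'}]`.
[cite: Gill1977, Prop. 5.2(i) (proof)] -/
theorem ansBit_two_pow (x : List Bool) :
    ansBit L' p x (2 ^ p.eval x.length) =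
      decide (2 ^ p.eval x.length < 2 * cnt (p.eval x.length) {y | boolPair x y ∈ L'}) := by
  set m := p.eval x.length with hm
  rw [ansBit, counter, ← hm, TM2Pass.length_encodeNat_eq_size, acc_two_pow]
  refine decide_eq_decide.mpr ?_
  rw [Nat.lt_size]
  have hcnt := cnt_le m {y | boolPair x y ∈ L'}
  cases m with
  | zero => simp only [pow_zero, Nat.zero_sub, Nat.sub_self, zero_add]; omega
  | succ m =>
    rw [Nat.add_sub_cancel, pow_succ]
    have hP : 1 ≤ 2 ^ m := Nat.one_le_two_pow
    constructor <;> intro h <;> omega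

/-- **The halted state.** From round `2^m` on the state is
`1 [2^m < 2 · cnt] ⟨0^m, ⟨x, counter (2^m)⟩⟩`: flag raised, answer bit = majority verdict.
[cite: Gill1977, Prop. 5.2(i) (proof)] -/
theorem iterate_roundFn_initFn_eq_of_le (x : List Bool) {n : ℕ} (hn : 2 ^ p.eval x.length ≤ n) :
    (roundFn L' p)^[n] (initFn p x) =
      mkState true (decide (2 ^ p.eval x.length < 2 * cnt (p.eval x.length) {y | boolPair x y ∈ L'}))
        (natBits (p.eval x.length) 0) x (counter L' p x (2 ^ p.eval x.length)) := by
  rw [iterate_roundFn_initFn_of_le L' p x hn, iterate_roundFn_initFn L' p x _ le_rfl, decide_eq_true rfl,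
    ansBit_two_pow, Nat.mod_self]

/-- Before round `2^m` the state is unflagged. [folklore] -/
theorem iterate_roundFn_initFn_eq_of_lt (x : List Bool) {n : ℕ} (hn : n < 2 ^ p.eval x.length) :
    (roundFn L' p)^[n] (initFn p x) =
      mkState false (ansBit L' p x n) (natBits (p.eval x.length) n) x (counter L' p x n) := by
  rw [iterate_roundFn_initFn L' p x n hn.le, decide_eq_false (Nat.ne_of_lt hn), Nat.mod_eq_of_lt hn]

/-- **The loop decides `PP` languages.** If `(L', p)` witness `L ∈ PP` in the sense of
`pMajority` (`x ∈ L ↔ Pr_y[⟨x, y⟩ ∈ L'] > 1/2` over `y ∈ {0,1}^{p(|x|)}`), then the answer read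
off the state after `2^{p(|x|)}` rounds (equivalently, after any later round) is `[x ∈ L]`.
[cite: Gill1977, Prop. 5.2(i) (PP ⊆ PSPACE)] -/
theorem ansFn_iterate_eq_encodeBool {L : Language Bool}
    (hL : ∀ x, x ∈ L ↔ 1 / 2 < uniformProb (p.eval x.length) {y : List Bool | boolPair x y ∈ L'})
    (x : List Bool) {n : ℕ} (hn : 2 ^ p.eval x.length ≤ n) :
    ansFn ((roundFn L' p)^[n] (initFn p x)) = encodeBool (L.boolIndicator x) := by
  rw [iterate_roundFn_initFn_eq_of_le L' p x hn, ansFn_mkState]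
  by_cases hx : x ∈ L
  · have h2 := (half_lt_uniformProb_iff _ _).1 ((hL x).1 hx)
    rw [decide_eq_true h2, (Set.mem_iff_boolIndicator _ _).1 hx]; rfl
  · have h2 : ¬ 2 ^ p.eval x.length < 2 * cnt (p.eval x.length) {y : List Bool | boolPair x y ∈ L'} :=
      fun h => hx ((hL x).2 ((half_lt_uniformProb_iff _ _).2 h))
    rw [decide_eq_false h2, (Set.notMem_iff_boolIndicator _ _).1 hx]; rfl

/-- The same, read directly as the second symbol of the halted word `1 a w`. [folklore] -/
theorem iterate_roundFn_initFn_eq_cons {L : Language Bool}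
    (hL : ∀ x, x ∈ L ↔ 1 / 2 < uniformProb (p.eval x.length) {y : List Bool | boolPair x y ∈ L'})
    (x : List Bool) {n : ℕ} (hn : 2 ^ p.eval x.length ≤ n) :
    ∃ w, (roundFn L' p)^[n] (initFn p x) = true :: L.boolIndicator x :: w := by
  refine ⟨bodyW ((roundFn L' p)^[n] (initFn p x)), ?_⟩
  have h := ansFn_iterate_eq_encodeBool L' p hL x hn
  rw [iterate_roundFn_initFn_eq_of_le L' p x hn, ansFn_mkState] at h
  rw [iterate_roundFn_initFn_eq_of_le L' p x hn, bodyW_mkState, mkState_eq_cons]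
  simpa [encodeBool] using h

end Loop

end PPEnum

end Literature.Computability.Complexity

end
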